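import Mathlib
import Summits.NavierStokesRegularity.NavierStokesRegularity.Theses.TaoLadderRungTwoBreak
import Summits.NavierStokesRegularity.NavierStokesRegularity.Theorems.WakeRatchetEternalViscousRate.Negative.EternalViscousRateFalseOfViscousBlockDSSWaves
import Summits.NavierStokesRegularity.NavierStokesRegularity.Theorems.WakeRatchetMinimalBlowupExtraction
import HarnessLib

set_option linter.dupNamespace false

/-!
# One bet: `ViscousBlockDSSWaves` (H) refutes the WHOLE K1-family of LADDER-NS, not only ⟨25647⟩

Evidence file (ns-idea-1 g9, card «monotone quantity hunt»; OBSERVATION-grade corollary, sorry-free).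
The WakeRatchet refuter landed `EternalViscousRate_false_of_ViscousBlockDSSWaves` (H ⇒ ¬⟨25647⟩, hence
¬⟨25584⟩).  Here: H ⇒ ¬⟨20452⟩ `NoLoudLadderOne` and H ⇒ ¬⟨20419⟩ `NoSurvivingEternalViscBddOne`
(ℛ20 TaoLadderRungTwoBreak / LatticeTransitLiouville), by two facts:
* a non-trivial block-DSS admissible viscous eternal solution is forward (S₁)-SURVIVING — the a = 1 weight
  `physWeight 1 ε₀ = (1+ε₀)^{-4}` is exactly compensated by the pinned lag `e^{T} = (1+ε₀)^{2p}`
  (`viscBlockDSS_lag`), so the weighted energy is constant along the block orbit of a non-zero point;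
* a surviving bounded solution is LOUD ON EVERY SHELL, by the tree's PROVED seeded slice
  `noSurvivingViscSeededBdd R 4096` (BoundedEternalSolutions §(τ′)).
MODEL lattice only. No summit is proved by a line.
-/

namespace Summit.NavierStokesRegularity.NavierStokesRegularity.Cruxes.EternalViscousRate.DissipationEdge

open Literature.Analysis.FluidPDE.TaoCascade
open Summit.NavierStokesRegularity.NavierStokesRegularity.Cruxes.MinimalBlowupExtraction.ClockedFrames (physWeight_one)
open Summit.NavierStokesRegularity.NavierStokesRegularity.Theorems.WakeRatchetViscDSS
  (ViscousBlockDSSWaves viscBlockDSS_lag)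

/-- Iterating the block shift forward: `W_{n + jp}(σ + jT) = W_n(σ)`. -/
theorem blockOrbit {W : ℤ → ℝ → Em 4} {p : ℕ} {T : ℝ}
    (hD : ∀ (n : ℤ) (σ : ℝ), W (n + p) σ = W n (σ - T)) :
    ∀ (j : ℕ) (n : ℤ) (σ : ℝ), W (n + ((j * p : ℕ) : ℤ)) (σ + (j : ℝ) * T) = W n σ := by
  intro j
  induction j with
  | zero => intro n σ; simp
  | succ j ih =>
    intro n σ
    have h1 : (n + (((j + 1) * p : ℕ) : ℤ)) = (n + ((j * p : ℕ) : ℤ)) + (p : ℤ) := by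
      push_cast; ring
    have h2 : σ + ((j + 1 : ℕ) : ℝ) * T = (σ + (j : ℝ) * T) + T := by push_cast; ring
    rw [h1, h2, hD, add_sub_cancel_right, ih]

/-- **Key invariance**: with the pinned lag, `physWeight 1 ε₀ ^ p · e^{2T} = 1`. -/
theorem weight_lag_cancel {ε₀ T : ℝ} {p : ℕ} (hε : 0 < ε₀) (hlag : Real.exp T = ((1 + ε₀) ^ 2) ^ p) :
    physWeight 1 ε₀ ^ p * Real.exp (2 * T) = 1 := by
  have hb : (1 + ε₀) ≠ 0 := by positivity
  have h2 : Real.exp (2 * T) = Real.exp T ^ 2 := by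
    rw [← Real.exp_nat_mul]; norm_num
  have h4 : (((1 + ε₀) ^ 2) ^ p) ^ 2 = ((1 + ε₀) ^ 4) ^ p := by
    rw [← pow_mul, ← pow_mul, ← pow_mul]; congr 1; ring
  rw [h2, hlag, h4, physWeight_one hε, inv_pow]
  exact inv_mul_cancel₀ (pow_ne_zero _ (pow_ne_zero _ hb))

/-- **A non-trivial block-DSS admissible viscous eternal solution (ν̂ > 0) is forward (S₁)-surviving.** -/
theorem survivingFwd_of_viscBlockDSS {ε₀ νh : ℝ} {α : Fin 4 → Fin 4 → Fin 4 → ℤ × ℤ × ℤ → ℝ}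
    {W : ℤ → ℝ → Em 4} (hε : 0 < ε₀) (hν : 0 < νh) (hW : IsEternalVisc ε₀ νh α W)
    {p : ℕ} (hp : 0 < p) {T : ℝ} (hD : ∀ (n : ℤ) (σ : ℝ), W (n + p) σ = W n (σ - T))
    {n₁ : ℤ} {σ₁ : ℝ} (hne : W n₁ σ₁ ≠ 0) :
    EternalSurvivingFwd 1 ε₀ W := by
  have hb : 0 < 1 + ε₀ := by linarith
  have hlag : Real.exp T = ((1 + ε₀) ^ 2) ^ p := viscBlockDSS_lag (by linarith) hν hW hD hne
  have hT : 0 < T := by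
    have h1 : (1 : ℝ) < ((1 + ε₀) ^ 2) ^ p := one_lt_pow₀ (by nlinarith) hp.ne'
    rw [← hlag] at h1
    exact Real.one_lt_exp_iff.1 h1
  have hkey := weight_lag_cancel hε hlag
  have hpw : 0 < physWeight 1 ε₀ := by rw [physWeight_one hε]; positivity
  -- move the non-zero point to a shell with nonnegative index
  have hj₀ : 0 ≤ n₁ + ((n₁.natAbs * p : ℕ) : ℤ) := by
    have h1 : -n₁ ≤ (n₁.natAbs : ℤ) := by
      have := Int.le_natAbs (a := -n₁); simpa using this
    have h2 : (n₁.natAbs : ℤ) ≤ ((n₁.natAbs * p : ℕ) : ℤ) := by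
      have : n₁.natAbs ≤ n₁.natAbs * p := Nat.le_mul_of_pos_right _ hp
      exact_mod_cast this
    linarith
  set n₀ : ℕ := (n₁ + ((n₁.natAbs * p : ℕ) : ℤ)).toNat with hn₀def
  have hn₀ : (n₀ : ℤ) = n₁ + ((n₁.natAbs * p : ℕ) : ℤ) := Int.toNat_of_nonneg hj₀
  set σ₀ : ℝ := σ₁ + (n₁.natAbs : ℝ) * T with hσ₀def
  have hW₀ : W n₀ σ₀ = W n₁ σ₁ := by
    rw [hn₀]; exact blockOrbit hD n₁.natAbs n₁ σ₁
  have hne₀ : W n₀ σ₀ ≠ 0 := by rw [hW₀]; exact hne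
  -- the surviving constant
  set c : ℝ := physWeight 1 ε₀ ^ n₀ * (Real.exp (2 * σ₀) * ‖W n₀ σ₀‖ ^ 2) with hcdef
  have hc : 0 < c := by
    have : 0 < ‖W n₀ σ₀‖ := norm_pos_iff.2 hne₀
    positivity
  refine ⟨c, hc, fun N => ?_⟩
  -- choose j with j ≥ N and σ₀ + jT ≥ N
  obtain ⟨j, hjN, hjσ⟩ : ∃ j : ℕ, N ≤ j ∧ (N : ℝ) ≤ σ₀ + (j : ℝ) * T := by
    refine ⟨N + ⌈((N : ℝ) - σ₀) / T⌉₊, Nat.le_add_right _ _, ?_⟩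
    have h1 : ((N : ℝ) - σ₀) / T ≤ (⌈((N : ℝ) - σ₀) / T⌉₊ : ℝ) := Nat.le_ceil _
    have h2 : (N : ℝ) - σ₀ ≤ (⌈((N : ℝ) - σ₀) / T⌉₊ : ℝ) * T := by
      rwa [div_le_iff₀ hT] at h1
    have h3 : (⌈((N : ℝ) - σ₀) / T⌉₊ : ℝ) * T ≤ ((N + ⌈((N : ℝ) - σ₀) / T⌉₊ : ℕ) : ℝ) * T := by
      push_cast; nlinarith
    linarith
  refine ⟨n₀ + j * p, ?_, σ₀ + (j : ℝ) * T, hjσ, ?_⟩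
  · calc N ≤ j := hjN
      _ ≤ j * p := Nat.le_mul_of_pos_right _ hp
      _ ≤ n₀ + j * p := Nat.le_add_left _ _
  · -- the weighted energy is constant along the block orbit
    have hWj : W ((n₀ + j * p : ℕ) : ℤ) (σ₀ + (j : ℝ) * T) = W n₀ σ₀ := by
      have := blockOrbit hD j (n₀ : ℤ) σ₀
      push_cast at this ⊢
      exact this
    have hwt : physWeight 1 ε₀ ^ (n₀ + j * p) * Real.exp (2 * (σ₀ + (j : ℝ) * T))
        = physWeight 1 ε₀ ^ n₀ * Real.exp (2 * σ₀) := by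
      have e1 : Real.exp (2 * (σ₀ + (j : ℝ) * T)) = Real.exp (2 * σ₀) * Real.exp (2 * T) ^ j := by
        rw [← Real.exp_nat_mul, ← Real.exp_add]; congr 1; ring
      have h1 : (physWeight 1 ε₀ ^ p) ^ j * Real.exp (2 * T) ^ j = 1 := by
        rw [← mul_pow, hkey, one_pow]
      rw [e1, pow_add, pow_mul']
      calc physWeight 1 ε₀ ^ n₀ * (physWeight 1 ε₀ ^ p) ^ j * (Real.exp (2 * σ₀) * Real.exp (2 * T) ^ j)
          = physWeight 1 ε₀ ^ n₀ * Real.exp (2 * σ₀)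
              * ((physWeight 1 ε₀ ^ p) ^ j * Real.exp (2 * T) ^ j) := by ring
        _ = physWeight 1 ε₀ ^ n₀ * Real.exp (2 * σ₀) := by rw [h1, mul_one]
    rw [hWj]
    have : physWeight 1 ε₀ ^ (n₀ + j * p) * (Real.exp (2 * (σ₀ + (j : ℝ) * T)) * ‖W n₀ σ₀‖ ^ 2)
        = c := by
      rw [hcdef, ← mul_assoc, hwt, mul_assoc]
    exact le_of_eq this.symm

/-- **H ⇒ ¬⟨stmt-NavierStokesRegularity-20419⟩** (`NoSurvivingEternalViscBddOne`, ℛ20's deciding crux, parent of the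
split ⟨20451⟩ ∧ ⟨20452⟩): the block-DSS profile itself is a surviving bounded admissible viscous eternal solution. -/
theorem NoSurvivingEternalViscBddOne_false_of_ViscousBlockDSSWaves (hH : ViscousBlockDSSWaves) :
    ¬ Theses.TaoLadderRungTwoBreak.NoSurvivingEternalViscBddOne := by
  intro hK
  obtain ⟨R, hR, hHR⟩ := hH
  obtain ⟨εs, hεs, HK⟩ := hK R hR
  obtain ⟨ε₀, hε₀, hle, α, hα, νh, W, p, T, hν, hp, hW, hU, hD, n₁, σ₁, hne⟩ := hHR εs hεs
  exact HK ε₀ hε₀ hle α hα νh W hW hU (survivingFwd_of_viscBlockDSS hε₀ hν hW hp hD hne)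

/-- **H ⇒ ¬⟨stmt-NavierStokesRegularity-20452⟩** (`NoLoudLadderOne`, the loud-ladder exclusion = split child (ρ+)
of ℛ20 / rank 4 of LatticeTransitLiouville): the block-DSS profile is surviving (above) and therefore LOUD ON EVERY
SHELL by the tree's proved seeded slice `noSurvivingViscSeededBdd R 4096` — exactly the hypothesis of
`NoLoudLadder R`, whose conclusion it then violates. -/
theorem NoLoudLadderOne_false_of_ViscousBlockDSSWaves (hH : ViscousBlockDSSWaves) :
    ¬ Theses.TaoLadderRungTwoBreak.NoLoudLadderOne := by
  intro hL
  obtain ⟨R, hR, hHR⟩ := hH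
  obtain ⟨εL, hεL, HL⟩ := hL R hR
  obtain ⟨ε₃, hε₃, HS⟩ := noSurvivingViscSeededBdd R
  obtain ⟨ε₀, hε₀, hle, α, hα, νh, W, p, T, hν, hp, hW, hU, hD, n₁, σ₁, hne⟩ :=
    hHR (min εL ε₃) (lt_min hεL hε₃)
  have hS : EternalSurvivingFwd 1 ε₀ W := survivingFwd_of_viscBlockDSS hε₀ hν hW hp hD hne
  have hloud : ∀ n₀ : ℕ, ∀ s₀ : ℝ, s₀ < νh ^ 2 / 4096 → ∃ σ : ℝ, s₀ < wtEnergy ε₀ W n₀ σ := by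
    intro n₀ s₀ hs₀
    by_contra hno
    push Not at hno
    exact HS ε₀ hε₀ (hle.trans (min_le_right _ _)) α hα νh W hν hW n₀
      (typeIBound_of_uniformBound hU n₀) ⟨s₀, hs₀, hno⟩ hS
  exact HL ε₀ hε₀ (hle.trans (min_le_left _ _)) α hα νh W hν hW hU hloud hS

/-- Packaging: **the K1-family of LADDER-NS is ONE bet, ¬H.**  (⟨25647⟩/⟨25584⟩ are refuted from H by the landed
`EternalViscousRate_false_of_ViscousBlockDSSWaves` / `TailRateRatchet_false_of_ViscousBlockDSSWaves`.) -/
theorem k1Family_false_of_ViscousBlockDSSWaves (hH : ViscousBlockDSSWaves) :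
    ¬ Theses.TaoLadderRungTwoBreak.NoSurvivingEternalViscBddOne
      ∧ ¬ Theses.TaoLadderRungTwoBreak.NoLoudLadderOne
      ∧ ¬ Theses.WakeRatchet.EternalViscousRate
      ∧ ¬ Theses.WakeRatchet.TailRateRatchet :=
  ⟨NoSurvivingEternalViscBddOne_false_of_ViscousBlockDSSWaves hH,
   NoLoudLadderOne_false_of_ViscousBlockDSSWaves hH,
   Theorems.WakeRatchetViscDSS.EternalViscousRate_false_of_ViscousBlockDSSWaves hH,
   Theorems.WakeRatchetViscDSS.TailRateRatchet_false_of_ViscousBlockDSSWaves hH⟩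

end Summit.NavierStokesRegularity.NavierStokesRegularity.Cruxes.EternalViscousRate.DissipationEdge
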